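import Mathlib
import HarnessLib
import Summits.HubbardSuperconductivity.HubbardSuperconductivity.Theorems.KLProgrammeKLRegimeSectorSliceCharSum
import Summits.HubbardSuperconductivity.HubbardSuperconductivity.Theorems.KLProgrammeKLRegimeTorusL1ThirdDifferencesMoment

/-!
# Route `KLProgramme` — engine support (route (L2), ADDITIVE weight, FIRST MOMENT): the WEIGHTED `ℓ¹` norm of ONE sector-pair character sum of
# a sectorised slice covariance from MULTIPLIER DATA and PROPAGATOR DATA of order THREE — the per-pair assembly behind `α_w(j)`

Cell `gate-hubbard-kl`, seat p3 (g9), for the ENGINE child stmt-HubbardSuperconductivity-20437 (`stub_engine_step_norms`, WEIGHTED lines `j ≥ 1`; located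
risk «(b)-Wt@j≥1», KL STATUS plan g17 13:31:52Z; memo HOME/p3/g9/WT-DECAY-SCALES.md).  The order-two, unweighted twin is k3c2-p3's
`…SectorSliceCharSum` (`norm_fwdDiff_iter_two_smul_mul_le_of_support`, `sliceCharSum_l1_le_of_data`): the row/column sums of `Sᵀ(F)·C^K_{(Λ,Λ′]}·S(F)`
are sums over partner sectors of per-pair `ℓ¹` norms `T(ω,ω′)` of character sums with symbol `G_{ωω′} = c₀·M_{ωω′}·Ψ̂` (`M` = multiplier product,
`Ψ̂` = slice profile through the frame band).  For the tree-WEIGHTED sums (weight `klScaleWt … j = 1 + Λ_j·d`) the per-pair quantity is the WEIGHTED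
`ℓ¹` norm `T_w(ω,ω′) = Σ_z (1 + s₀|z̃₁| + s₁|z̃₂|₁)·‖S[G_{ωω′}](z)‖`, and the master lemma `sum_wt_norm_charSum_le_of_third_differences` wants THIRD
single-direction differences of `G` in the five directions.  Here:

* §1 `fwdDiff_iter_three_mul_apply` (discrete Leibniz at order three), `norm_fwdDiff_iter_three_mul_le` (norm form, data everywhere) and
  **`norm_fwdDiff_iter_three_smul_mul_le_of_support`** — `‖Δ_w³(c₀·M·Ψ)(q)‖ ≤ ‖c₀‖·(a₀b₃ + 3a₁b₂ + 3a₂b₁ + a₃b₀)` at EVERY `q`, with the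
  propagator data `b_k ≥ ‖Δ_w^kΨ‖` needed only on the `w`-neighbourhood `{q : ∃ j ≤ 3, M(q + j•w) ≠ 0}` of the support of `M` (elsewhere all four
  Leibniz terms vanish) — the anisotropic smallness of the propagator's differences is only available there;
* §2 **`sliceCharSumWt_l1_le_of_data`** — the per-pair WEIGHTED bound: given rates `s₀,…,s₃`, an integer frame `(v⊥, v)`, a near radius, a support
  count `N_s` for `M`, `‖c₀·M·Ψ‖ ≤ A₀` and for each of the five directions «third-difference bound ≤ A₀·(4/(s_wP_w))³»,
  `T_w(ω,ω′) ≤ √(32768(1/s₀+1)[C_w²·4(…)(…) + 16(1/s₁+1)²/(1+s₁R₀)])·√(21·P·L²·N_s)·A₀`.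

The numeric choice of rates on an admissible frame (`|v| ≍ 2^j`, `s₀ ≍ Λβ/P`, `s₁ ≍ s₂|v| ≍ Λ`, `s₃|v| ≍ 2^{−j}`) and the ORDER-THREE symbol data
(multipliers: p4 lineage; slice profile through `e_{K_n}`: third derivatives of the band — see the memo's (Wt-D3) constraint / the per-piece route
below `j*(n)`) are the instance's.  Everything is proved; no definitions, no named facts. [folklore]

References: G. Benfatto, A. Giuliani, V. Mastropietro, Ann. Henri Poincaré 7 (2006) 809–898, Lemma 2.2 (2.52), §2.8 (2.81) and footnote ¹; M. Disertori,
V. Rivasseau, Comm. Math. Phys. 215 (2000) 251–290, §IV.2 Lemma 4, App. A Lemma 12.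
-/

noncomputable section

namespace Summit.HubbardSuperconductivity.HubbardSuperconductivity.Theorems.TorusFourierL2

set_option linter.dupNamespace false -- summit = problem name (single-conjunct summit), D-0017

open Finset Complex Literature.MathematicalPhysics.QuantumLattice Literature.Probability.LatticeModels
open scoped Real

/-! ### §1 Discrete Leibniz at order three, with propagator data only near the support of the multiplier -/

section Product

variable {A : Type*} [AddCommMonoid A]

/-- **Discrete Leibniz at order three**: `Δ³(fg)(x) = f(x+3w)·Δ³g(x) + 3·Δf(x+2w)·Δ²g(x) + 3·Δ²f(x+w)·Δg(x) + Δ³f(x)·g(x)`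
(`x + 2w`, `x + 3w` written `x + w + w`, `x + w + w + w`). [folklore] -/
theorem fwdDiff_iter_three_mul_apply {R : Type*} [CommRing R] (w : A) (f g : A → R) (x : A) :
    (fwdDiff w)^[3] (fun y => f y * g y) x =
      f (x + w + w + w) * (fwdDiff w)^[3] g x + 3 * (fwdDiff w f (x + w + w) * (fwdDiff w)^[2] g x) +
        3 * ((fwdDiff w)^[2] f (x + w) * fwdDiff w g x) + (fwdDiff w)^[3] f x * g x := by
  simp only [Function.iterate_succ_apply', Function.iterate_zero_apply, fwdDiff]
  ring

/-- **Norm form of the order-three Leibniz rule** (data everywhere): `‖Δ_w³(fg)‖ ≤ a₀b₃ + 3a₁b₂ + 3a₂b₁ + a₃b₀`. [folklore] -/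
theorem norm_fwdDiff_iter_three_mul_le (w : A) (f g : A → ℂ) {a₀ a₁ a₂ a₃ b₀ b₁ b₂ b₃ : ℝ}
    (hf0 : ∀ x, ‖f x‖ ≤ a₀) (hf1 : ∀ x, ‖fwdDiff w f x‖ ≤ a₁) (hf2 : ∀ x, ‖(fwdDiff w)^[2] f x‖ ≤ a₂)
    (hf3 : ∀ x, ‖(fwdDiff w)^[3] f x‖ ≤ a₃)
    (hg0 : ∀ x, ‖g x‖ ≤ b₀) (hg1 : ∀ x, ‖fwdDiff w g x‖ ≤ b₁) (hg2 : ∀ x, ‖(fwdDiff w)^[2] g x‖ ≤ b₂)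
    (hg3 : ∀ x, ‖(fwdDiff w)^[3] g x‖ ≤ b₃) (x : A) :
    ‖(fwdDiff w)^[3] (fun y => f y * g y) x‖ ≤ a₀ * b₃ + 3 * (a₁ * b₂) + 3 * (a₂ * b₁) + a₃ * b₀ := by
  have ha0 : 0 ≤ a₀ := (norm_nonneg _).trans (hf0 x)
  have ha1 : 0 ≤ a₁ := (norm_nonneg _).trans (hf1 x)
  have ha2 : 0 ≤ a₂ := (norm_nonneg _).trans (hf2 x)
  have hb0 : 0 ≤ b₀ := (norm_nonneg _).trans (hg0 x)
  rw [fwdDiff_iter_three_mul_apply]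
  refine (norm_add_le _ _).trans (add_le_add ((norm_add_le _ _).trans (add_le_add ((norm_add_le _ _).trans (add_le_add ?_ ?_)) ?_)) ?_)
  · rw [norm_mul]; exact mul_le_mul (hf0 _) (hg3 _) (norm_nonneg _) ha0
  · rw [norm_mul, norm_mul, Complex.norm_ofNat]
    exact mul_le_mul_of_nonneg_left (mul_le_mul (hf1 _) (hg2 _) (norm_nonneg _) ha1) (by norm_num)
  · rw [norm_mul, norm_mul, Complex.norm_ofNat]
    exact mul_le_mul_of_nonneg_left (mul_le_mul (hf2 _) (hg1 _) (norm_nonneg _) ha2) (by norm_num)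
  · rw [norm_mul]; exact mul_le_mul (hf3 _) (hg0 _) (norm_nonneg _) ((norm_nonneg _).trans (hf3 x))

/-- **Third difference of `c₀·(M·Ψ)`** with `‖Δ_w^kM‖ ≤ a_k` everywhere (`k ≤ 3`) and `‖Δ_w^kΨ‖ ≤ b_k` at the points `q` with `M(q + j•w) ≠ 0`
for some `j ≤ 3`: `‖Δ_w³(c₀·M·Ψ)(q)‖ ≤ ‖c₀‖·(a₀b₃ + 3a₁b₂ + 3a₂b₁ + a₃b₀)` at EVERY `q` (elsewhere all four Leibniz terms vanish). [folklore] -/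
theorem norm_fwdDiff_iter_three_smul_mul_le_of_support (w : A) (c₀ : ℂ) (Mf Ψ : A → ℂ) {a₀ a₁ a₂ a₃ b₀ b₁ b₂ b₃ : ℝ}
    (ha0 : 0 ≤ a₀) (ha1 : 0 ≤ a₁) (ha2 : 0 ≤ a₂) (ha3 : 0 ≤ a₃) (hb0 : 0 ≤ b₀) (hb1 : 0 ≤ b₁) (hb2 : 0 ≤ b₂) (hb3 : 0 ≤ b₃)
    (hM0 : ∀ x, ‖Mf x‖ ≤ a₀) (hM1 : ∀ x, ‖fwdDiff w Mf x‖ ≤ a₁) (hM2 : ∀ x, ‖(fwdDiff w)^[2] Mf x‖ ≤ a₂)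
    (hM3 : ∀ x, ‖(fwdDiff w)^[3] Mf x‖ ≤ a₃)
    (hΨ0 : ∀ x, (∃ j : ℕ, j ≤ 3 ∧ Mf (x + j • w) ≠ 0) → ‖Ψ x‖ ≤ b₀)
    (hΨ1 : ∀ x, (∃ j : ℕ, j ≤ 3 ∧ Mf (x + j • w) ≠ 0) → ‖fwdDiff w Ψ x‖ ≤ b₁)
    (hΨ2 : ∀ x, (∃ j : ℕ, j ≤ 3 ∧ Mf (x + j • w) ≠ 0) → ‖(fwdDiff w)^[2] Ψ x‖ ≤ b₂)
    (hΨ3 : ∀ x, (∃ j : ℕ, j ≤ 3 ∧ Mf (x + j • w) ≠ 0) → ‖(fwdDiff w)^[3] Ψ x‖ ≤ b₃) (x : A) :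
    ‖(fwdDiff w)^[3] (fun y => c₀ * (Mf y * Ψ y)) x‖ ≤ ‖c₀‖ * (a₀ * b₃ + 3 * (a₁ * b₂) + 3 * (a₂ * b₁) + a₃ * b₀) := by
  -- pull out the constant
  have hlin : (fwdDiff w)^[3] (fun y => c₀ * (Mf y * Ψ y)) x = c₀ * (fwdDiff w)^[3] (fun y => Mf y * Ψ y) x := by
    simp only [fwdDiff_iter_eq_sum_shift, Finset.mul_sum, zsmul_eq_mul]
    refine Finset.sum_congr rfl fun k _ => by ring
  rw [hlin, norm_mul]
  refine mul_le_mul_of_nonneg_left ?_ (norm_nonneg _)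
  by_cases hnear : ∃ j : ℕ, j ≤ 3 ∧ Mf (x + j • w) ≠ 0
  · rw [fwdDiff_iter_three_mul_apply]
    refine (norm_add_le _ _).trans (add_le_add ((norm_add_le _ _).trans (add_le_add ((norm_add_le _ _).trans (add_le_add ?_ ?_)) ?_)) ?_)
    · rw [norm_mul]; exact mul_le_mul (hM0 _) (hΨ3 x hnear) (norm_nonneg _) ha0
    · rw [norm_mul, norm_mul, Complex.norm_ofNat]
      exact mul_le_mul_of_nonneg_left (mul_le_mul (hM1 _) (hΨ2 x hnear) (norm_nonneg _) ha1) (by norm_num)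
    · rw [norm_mul, norm_mul, Complex.norm_ofNat]
      exact mul_le_mul_of_nonneg_left (mul_le_mul (hM2 _) (hΨ1 x hnear) (norm_nonneg _) ha2) (by norm_num)
    · rw [norm_mul]; exact mul_le_mul (hM3 _) (hΨ0 x hnear) (norm_nonneg _) ha3
  · -- all of `M(x)`, `M(x+w)`, `M(x+2w)`, `M(x+3w)` vanish
    push Not at hnear
    have h0 : Mf x = 0 := by simpa using hnear 0 (by norm_num)
    have h1 : Mf (x + w) = 0 := by simpa using hnear 1 (by norm_num)
    have h2 : Mf (x + w + w) = 0 := by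
      have := hnear 2 (by norm_num); rwa [two_nsmul, ← add_assoc] at this
    have h3 : Mf (x + w + w + w) = 0 := by
      have := hnear 3 le_rfl
      rwa [show (3 : ℕ) • w = w + w + w by rw [succ_nsmul, two_nsmul], ← add_assoc, ← add_assoc] at this
    have hz : (fwdDiff w)^[3] (fun y => Mf y * Ψ y) x = 0 := by
      simp only [Function.iterate_succ_apply', Function.iterate_zero_apply, fwdDiff, h0, h1, h2, h3, zero_mul, sub_zero]
    rw [hz, norm_zero]
    positivity

end Product

/-! ### §2 The per-pair WEIGHTED bound from data -/

/-- **The weighted `ℓ¹` norm of one sector-pair character sum from data.**  Symbol `G(q) = c₀·(M(q)·Ψ(q))` on `(ℤ/P)¹ × (ℤ/L)²`; multiplier data: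
`#{M ≠ 0} ≤ N_s`; `‖G‖ ≤ A₀`; for each of the five directions `w ∈ {(1,0), (0,e₁), (0,e₂), (0,v⊥), (0,v)}` a bound of the THIRD difference of `G`
(obtained from §1) `≤ A₀·(4/(s_wP_w))³`.  THEN
`Σ_z (1 + s₀|z̃₁| + s₁|(z₂)̃₁| + s₁|(z₂)̃₂|)·‖Σ_q χ_{q₁}(z₁)χ_{q₂}(z₂) • G(q)‖
  ≤ √(32768(1/s₀+1)[C_w²·4(2√2/(s₂|v|)+2)(2√2/(s₃|v|)+2) + 16(1/s₁+1)²/(1+s₁R₀)])·√(21·P·L²·N_s)·A₀` — the master lemma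
`sum_wt_norm_charSum_le_of_third_differences` with the support of `G` controlled by that of `M`. [cite: BenfattoGiulianiMastropietro2006, §2.8 (2.81)] -/
theorem sliceCharSumWt_l1_le_of_data {P L : ℕ} [NeZero P] [NeZero L] (c₀ : ℂ) (Mf Ψ : TorusSite 1 P × TorusSite 2 L → ℂ)
    (v : Fin 2 → ℤ) (hv : v ≠ 0) {s₀ s₁ s₂ s₃ : ℝ} (hs₀ : 0 < s₀) (hs₁ : 0 < s₁) (hs₂ : 0 < s₂) (hs₃ : 0 < s₃)
    {R₀ : ℕ} (hR₀ : 2 * (|v 0| + |v 1|) * (R₀ : ℤ) < L) {A₀ : ℝ} (hA₀ : 0 ≤ A₀) {Ns : ℕ}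
    (hsupp : (univ.filter fun q => Mf q ≠ 0).card ≤ Ns)
    (hsup : ∀ q, ‖c₀ * (Mf q * Ψ q)‖ ≤ A₀)
    (h₀ : ∀ q, ‖(fwdDiff ((fun _ : Fin 1 => (1 : ZMod P)), (0 : TorusSite 2 L)))^[3] (fun y => c₀ * (Mf y * Ψ y)) q‖ ≤
      A₀ * (4 / (s₀ * P)) ^ 3)
    (h₁ : ∀ q (i : Fin 2), ‖(fwdDiff ((0 : TorusSite 1 P), (Pi.single i (1 : ZMod L) : TorusSite 2 L)))^[3]
        (fun y => c₀ * (Mf y * Ψ y)) q‖ ≤ A₀ * (4 / (s₁ * L)) ^ 3)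
    (h₂ : ∀ q, ‖(fwdDiff ((0 : TorusSite 1 P), (fun j => ((![-v 1, v 0] j : ℤ) : ZMod L))))^[3]
        (fun y => c₀ * (Mf y * Ψ y)) q‖ ≤ A₀ * (4 / (s₂ * L)) ^ 3)
    (h₃ : ∀ q, ‖(fwdDiff ((0 : TorusSite 1 P), (fun j => ((v j : ℤ) : ZMod L))))^[3] (fun y => c₀ * (Mf y * Ψ y)) q‖ ≤
        A₀ * (4 / (s₃ * L)) ^ 3) :
    ∑ z : TorusSite 1 P × TorusSite 2 L,
      (1 + s₀ * |(((z.1 0).valMinAbs : ℤ) : ℝ)| + s₁ * |(((z.2 0).valMinAbs : ℤ) : ℝ)| + s₁ * |(((z.2 1).valMinAbs : ℤ) : ℝ)|) *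
        ‖∑ q : TorusSite 1 P × TorusSite 2 L, (torusChar q.1 z.1 * torusChar q.2 z.2) • (c₀ * (Mf q * Ψ q))‖ ≤
      Real.sqrt (32768 * (1 / s₀ + 1) *
          ((1 + 2 * Real.sqrt 2 * s₁ / (s₂ * Real.sqrt ((v 0 : ℝ) ^ 2 + (v 1 : ℝ) ^ 2)) +
              2 * Real.sqrt 2 * s₁ / (s₃ * Real.sqrt ((v 0 : ℝ) ^ 2 + (v 1 : ℝ) ^ 2))) ^ 2 *
            (4 * ((2 * Real.sqrt 2 / (s₂ * Real.sqrt ((v 0 : ℝ) ^ 2 + (v 1 : ℝ) ^ 2)) + 2) *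
              (2 * Real.sqrt 2 / (s₃ * Real.sqrt ((v 0 : ℝ) ^ 2 + (v 1 : ℝ) ^ 2)) + 2)))
            + 16 * (1 / s₁ + 1) ^ 2 / (1 + s₁ * R₀))) *
        Real.sqrt (21 * P * (L : ℝ) ^ 2 * Ns) * A₀ := by
  classical
  exact sum_wt_norm_charSum_le_of_third_differences (fun q => c₀ * (Mf q * Ψ q)) v hv hs₀ hs₁ hs₂ hs₃ hR₀ hA₀
    ((card_support_smul_mul_le c₀ Mf Ψ).trans hsupp) hsup h₀ h₁ h₂ h₃

end Summit.HubbardSuperconductivity.HubbardSuperconductivity.Theorems.TorusFourierL2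

end
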